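import Literature.NumberTheory.Automorphic.CompactGroupCharacterProjectionIsotypic
import HarnessLib

/-!
# The dimension of an isotypic component: `dim H_τ = dim τ · dim Hom_G(τ, π) = dim τ · ⟨χ_π, χ_τ⟩`

Topic `NumberTheory/Automorphic` (vocabulary of `HilbertRepSpectrum` / `HilbertRepIsotypicComponent`:
`IsUnitary`, `IsStronglyContinuous`, `isotypicComponent`), continuing `CompactGroupCharacterProjectionIsotypic`
(`charProj_eq_starProjection_isotypicComponent`: the character projector `P_τ = dim τ · ∫ conj χ_τ(g) π(g) dμ` of
`RepresentationTheory/CompactGroups/CharacterProjection` is the orthogonal projection onto the `τ`-isotypic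
component).  Theorems only; no definition, no named fact.

T. Bröcker, T. tom Dieck, *Representations of Compact Lie Groups* (GTM 98, 1985).  II (1.14)–(1.15) (PDF pp. 69–70):
for a (finite-dimensional, continuous) representation `V` of the compact group `G` and an irreducible `W`, the
multiplicity of `W` in `V` is `dim_ℂ Hom_G(W, V)`, the `W`-isotypical summand `V(W)` is the image of the isomorphism
`d_W : Hom_G(W, V) ⊗ W → V(W)` — so that `dim V(W) = dim Hom_G(W, V) · dim W` — and `V(W)` is generated by the
irreducible submodules of `V` isomorphic to `W`; II Thm. (4.11)(ii) (PDF p. 79): `⟨χ_W', χ_V⟩ = ∫ conj χ_V χ_W' =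
dim Hom_G(V, W')`, whence in the proof of II Thm. (4.12) the multiplicities are `n_j = ⟨χ_V, χ_{V(j)}⟩`; III Thm. (5.10)
(PDF p. 135): `P_χ` is the projection onto the isotypical part `H_χ`.  A. Deitmar, S. Echterhoff, *Principles of
Harmonic Analysis* (2nd ed. 2014), Prop. 7.3.3: the orthogonal projection onto the isotype is `dim τ ∫ conj χ_τ π`.

Here `π` is a unitary strongly continuous representation of a compact Hausdorff group `G` on a FINITE-dimensional
Hilbert space `H`, `τ` an irreducible unitary representation on `E`, `μ` a left-invariant probability measure on `G`,
and `H_τ = π.isotypicComponent τ` (the closed span of the irreducible closed subrepresentations unitarily equivalent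
to `τ` — for finite-dimensional unitary `π` this is Bröcker–tom Dieck's `V(W)` by II (1.15), every invariant subspace
being closed and every embedded copy of `τ` being unitarily equivalent to `τ`,
`areUnitarilyEquivalent_toContRep_of_equiv`).

* `smul_integral_conj_character_smul_apply`, `trace_smul_integral_conj_character_smul` — the operator
  `dim E • ∫ conj χ_τ(g) • π g dμ ∈ End(H)` acts as `Schur.charProj μ τ π` and has trace `dim E · ∫ conj χ_τ χ_π dμ`
  (the trace commutes with the integral, as in the printed proof of II (4.11)); `trace_charProjL_eq_mul_integral` —
  the same for the bundled projector `Schur.charProjL`;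
* `finrank_isotypicComponent_eq_mul_integral` — **`dim H_τ = dim E · ∫ conj χ_τ(g) χ_π(g) dμ = dim τ · ⟨χ_π, χ_τ⟩`**
  (trace of the projection `P_τ` onto `H_τ`, III (5.10) / Prop. 7.3.3, against the formula above);
* `finrank_isotypicComponent_eq_mul_finrank_intertwiners` — **II (1.14): `dim H_τ = dim E · dim Hom_G(τ, π)`** with
  `Hom_G = Schur.intertwiners τ π` (via II (4.11)(ii), `Schur.finrank_intertwiners_eq_integral`; no measure in the
  statement — a normalised Haar measure is chosen inside the proof), and
  `finrank_isotypicComponent_eq_mul_finrank_intertwiningMap` — the same with Mathlib's `Representation.IntertwiningMap`;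
* `finrank_dvd_finrank_isotypicComponent` — `dim E ∣ dim H_τ`;
* `isotypicComponent_eq_bot_iff_integral_eq_zero` / `isotypicComponent_ne_bot_iff_exists_intertwiner` — **`τ` occurs
  in `π` iff `⟨χ_π, χ_τ⟩ ≠ 0` iff there is a non-zero `G`-map `τ → π`** (II (1.13)–(1.14): "this multiplicity is nonzero
  if and only if `W` is contained in `V`").

## References
* T. Bröcker, T. tom Dieck, *Representations of Compact Lie Groups*, GTM 98 (1985), II (1.14)–(1.15) PDF pp. 69–70,
  II Thm (4.11)–(4.12) PDF p. 79, III Thm (5.10) PDF p. 135 [BrockerTomDieck1985].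
* A. Deitmar, S. Echterhoff, *Principles of Harmonic Analysis*, 2nd ed. (2014), §7.3, Prop. 7.3.3 [DeitmarEchterhoff2014].

## Provenance
Lane `lit-hodgefound` (HOME `run/shared/lean/pub/lit-hodgefound/`), prover seat `lit-hodgefound-p05` generation 7 (Layer 0:
compact groups — multiplicities of `K`-types; row g6-#8 of the seat's board).
-/

noncomputable section

open MeasureTheory Complex ContRepresentation TopologicalSpace
open Literature.RepresentationTheory.CompactGroups
open scoped InnerProductSpace ComplexConjugate

namespace Literature.NumberTheory.Automorphic

section Main

variable {G : Type*} [TopologicalSpace G] [Group G] [IsTopologicalGroup G] [MeasurableSpace G] [BorelSpace G]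
  [CompactSpace G]
variable {H : Type*} [NormedAddCommGroup H] [InnerProductSpace ℂ H] [CompleteSpace H] [FiniteDimensional ℂ H]
variable {E : Type*} [NormedAddCommGroup E] [InnerProductSpace ℂ E] [FiniteDimensional ℂ E]
variable {π : ContRepresentation ℂ G H} {τ : ContRepresentation ℂ G E}
variable (μ : Measure G) [IsProbabilityMeasure μ] [μ.IsMulLeftInvariant]

/-! ### The projector as an operator-valued integral and its trace -/

omit [IsTopologicalGroup G] [CompleteSpace H] [FiniteDimensional ℂ H] [μ.IsMulLeftInvariant] in
/-- The operator-valued integrand `g ↦ conj χ_τ(g) • π g` is Bochner integrable on the compact group (norm-continuous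
`π`, continuous `χ_τ`). [cite: BrockerTomDieck1985, III (5.9)] -/
theorem integrable_conj_character_smul (hπ : Continuous (π : G → H →L[ℂ] H))
    (hτ : Continuous (τ : G → E →L[ℂ] E)) :
    Integrable (fun g : G => conj (Schur.character τ g) • (π g : H →L[ℂ] H)) μ :=
  ((continuous_conj.comp (Schur.continuous_character hτ)).smul hπ).integrable_of_hasCompactSupport
    (HasCompactSupport.of_compactSpace _)

omit [IsTopologicalGroup G] [FiniteDimensional ℂ H] [μ.IsMulLeftInvariant] in
/-- **The character projector is the operator `e_τ = dim E • ∫ conj χ_τ(g) • π g dμ`** acting on `H`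
(Bröcker–tom Dieck III (5.9)–(5.10): `P_χ v = e_χ * v`; evaluation at `v` commutes with the Bochner integral).
[cite: BrockerTomDieck1985, III Thm (5.10)] -/
theorem smul_integral_conj_character_smul_apply (hπ : Continuous (π : G → H →L[ℂ] H))
    (hτ : Continuous (τ : G → E →L[ℂ] E)) (v : H) :
    ((Module.finrank ℂ E : ℂ) • ∫ g, conj (Schur.character τ g) • (π g : H →L[ℂ] H) ∂μ) v =
      Schur.charProj μ τ π v := by
  rw [Schur.charProj_def, smul_apply,
    ← ContinuousLinearMap.apply_apply (v := v), ← (ContinuousLinearMap.apply ℂ H v).integral_comp_comm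
      (integrable_conj_character_smul μ hπ hτ)]
  simp only [ContinuousLinearMap.apply_apply, ContinuousLinearMap.map_smul]

omit [IsTopologicalGroup G] [μ.IsMulLeftInvariant] in
/-- **`Tr(dim E • ∫ conj χ_τ(g) • π g dμ) = dim E · ∫ conj χ_τ(g) χ_π(g) dμ`** — the trace is linear and commutes
with the integral (the printed proof of Bröcker–tom Dieck II Thm. (4.11): `Tr ∫ l_g dg = ∫ Tr(l_g) dg = ∫ χ_V`).
[cite: BrockerTomDieck1985, II Thm (4.11)] -/
theorem trace_smul_integral_conj_character_smul (hπ : Continuous (π : G → H →L[ℂ] H))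
    (hτ : Continuous (τ : G → E →L[ℂ] E)) :
    LinearMap.trace ℂ H (((Module.finrank ℂ E : ℂ) • ∫ g, conj (Schur.character τ g) • (π g : H →L[ℂ] H) ∂μ :
        H →L[ℂ] H) : H →ₗ[ℂ] H) =
      (Module.finrank ℂ E : ℂ) * ∫ g, conj (Schur.character τ g) * Schur.character π g ∂μ := by
  rw [← Schur.traceCLM_apply, map_smul, ← (Schur.traceCLM H).integral_comp_comm
    (integrable_conj_character_smul μ hπ hτ), smul_eq_mul]
  congr 1
  refine integral_congr_ae (Filter.Eventually.of_forall fun g => ?_)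
  simp only [map_smul, Schur.traceCLM_apply, smul_eq_mul]
  rfl

omit [IsTopologicalGroup G] [μ.IsMulLeftInvariant] in
/-- **`Tr P_τ = dim E · ∫ conj χ_τ(g) χ_π(g) dμ`** for the bundled character projector `Schur.charProjL` of a unitary
strongly continuous `π` on a finite-dimensional Hilbert space (`χ_π = Schur.character π`).
[cite: BrockerTomDieck1985, II Thm (4.11)] [cite: BrockerTomDieck1985, III Thm (5.10)] -/
theorem trace_charProjL_eq_mul_integral (hπc : π.IsStronglyContinuous) (hπu : π.IsUnitary)
    (hτ : Continuous (τ : G → E →L[ℂ] E)) (hτu : ∀ (g : G) (v w : E), ⟪τ g v, τ g w⟫_ℂ = ⟪v, w⟫_ℂ) :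
    LinearMap.trace ℂ H ((Schur.charProjL μ τ π hτ hτu (fun v => hπc v) (fun g v w => hπu.inner_map_map g v w) :
        H →L[ℂ] H) : H →ₗ[ℂ] H) =
      (Module.finrank ℂ E : ℂ) * ∫ g, conj (Schur.character τ g) * Schur.character π g ∂μ := by
  have hπ : Continuous (π : G → H →L[ℂ] H) := Schur.continuous_of_forall_continuous_apply fun v => hπc v
  rw [← trace_smul_integral_conj_character_smul μ hπ hτ]
  congr 1
  refine LinearMap.ext fun v => ?_
  simp only [ContinuousLinearMap.coe_coe, Schur.charProjL_apply]
  exact (smul_integral_conj_character_smul_apply μ hπ hτ v).symm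

/-! ### The dimension of the isotypic component -/

/-- **`dim H_τ = dim E · ∫ conj χ_τ(g) χ_π(g) dμ = dim τ · ⟨χ_π, χ_τ⟩`** for a unitary strongly continuous `π` on a
finite-dimensional Hilbert space and an irreducible unitary `τ` (Bröcker–tom Dieck II (4.11)–(4.12): `n_j dim V(j)`
with `n_j = ⟨χ_V, χ_{V(j)}⟩`; III Thm. (5.10) / Deitmar–Echterhoff Prop. 7.3.3: `P_τ` is the projection onto `H_τ`, so
`dim H_τ = Tr P_τ`). [cite: BrockerTomDieck1985, II Thm (4.11)] [cite: BrockerTomDieck1985, III Thm (5.10)]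
[cite: DeitmarEchterhoff2014, Prop. 7.3.3] -/
theorem finrank_isotypicComponent_eq_mul_integral [T2Space G] (hπc : π.IsStronglyContinuous) (hπu : π.IsUnitary)
    (hτ : Continuous (τ : G → E →L[ℂ] E)) [τ.toRepresentation.IsIrreducible]
    (hτu : ∀ (g : G) (v w : E), ⟪τ g v, τ g w⟫_ℂ = ⟪v, w⟫_ℂ) :
    (Module.finrank ℂ (π.isotypicComponent τ).toSubmodule : ℂ) =
      (Module.finrank ℂ E : ℂ) * ∫ g, conj (Schur.character τ g) * Schur.character π g ∂μ := by
  -- `P_τ` is a projection onto `H_τ`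
  have hP : LinearMap.IsProj (π.isotypicComponent τ).toSubmodule
      ((Schur.charProjL μ τ π hτ hτu (fun v => hπc v) (fun g v w => hπu.inner_map_map g v w) : H →L[ℂ] H) :
        H →ₗ[ℂ] H) :=
    { map_mem := fun v => by
        rw [ContinuousLinearMap.coe_coe, Schur.charProjL_apply]
        exact charProj_mem_isotypicComponent μ hπc hπu hτ hτu v
      map_id := fun v hv => by
        rw [ContinuousLinearMap.coe_coe, Schur.charProjL_apply]
        exact (charProj_eq_self_iff_mem_isotypicComponent μ hπc hπu hτ hτu v).mpr hv }
  rw [← hP.trace, trace_charProjL_eq_mul_integral μ hπc hπu hτ hτu]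

omit [MeasurableSpace G] [BorelSpace G] in
/-- A compact group carries a left-invariant Borel probability measure (the normalised Haar measure, Mathlib
`MeasureTheory.Measure.haarMeasure` with `K₀ = G`). [cite: BrockerTomDieck1985, I Thm (5.13)] -/
private theorem exists_isProbabilityMeasure_isMulLeftInvariant :
    ∃ μ : @Measure G (borel G), @IsProbabilityMeasure G (borel G) μ ∧ @Measure.IsMulLeftInvariant G (borel G) _ μ := by
  letI : MeasurableSpace G := borel G
  haveI : BorelSpace G := ⟨rfl⟩
  refine ⟨Measure.haarMeasure ⊤, ⟨?_⟩, inferInstance⟩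
  have h : Measure.haarMeasure (⊤ : PositiveCompacts G) ((⊤ : PositiveCompacts G) : Set G) = 1 :=
    Measure.haarMeasure_self
  simpa only [PositiveCompacts.coe_top] using h

/-- **Bröcker–tom Dieck II (1.14): `dim H_τ = dim E · dim Hom_G(τ, π)`** — the isotypic component of an irreducible
unitary `τ` in a unitary strongly continuous representation `π` of a compact Hausdorff group on a finite-dimensional
Hilbert space has dimension `dim τ` times the multiplicity `dim_ℂ Hom_G(τ, π)` (`Hom_G = Schur.intertwiners τ π`, the
intertwining operators `E →L[ℂ] H`).  Proof via the character: `dim H_τ = dim E · ⟨χ_π, χ_τ⟩`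
(`finrank_isotypicComponent_eq_mul_integral`) and `⟨χ_π, χ_τ⟩ = dim Hom_G(τ, π)` (II Thm. (4.11)(ii),
`Schur.finrank_intertwiners_eq_integral`) for a normalised Haar measure. [cite: BrockerTomDieck1985, II Prop (1.14)]
[cite: BrockerTomDieck1985, II Thm (4.11)] -/
theorem finrank_isotypicComponent_eq_mul_finrank_intertwiners [T2Space G] (hπc : π.IsStronglyContinuous)
    (hπu : π.IsUnitary) (hτ : Continuous (τ : G → E →L[ℂ] E)) [τ.toRepresentation.IsIrreducible]
    (hτu : ∀ (g : G) (v w : E), ⟪τ g v, τ g w⟫_ℂ = ⟪v, w⟫_ℂ) :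
    Module.finrank ℂ (π.isotypicComponent τ).toSubmodule =
      Module.finrank ℂ E * Module.finrank ℂ (Schur.intertwiners τ π) := by
  borelize G
  obtain ⟨ν, hν, hν'⟩ := exists_isProbabilityMeasure_isMulLeftInvariant (G := G)
  have hπ : Continuous (π : G → H →L[ℂ] H) := Schur.continuous_of_forall_continuous_apply fun v => hπc v
  have h1 := finrank_isotypicComponent_eq_mul_integral ν hπc hπu hτ hτu
  rw [← Schur.finrank_intertwiners_eq_integral ν hτ hπ hτu] at h1
  exact_mod_cast h1

/-- **`dim H_τ = dim E · dim_ℂ IntertwiningMap(τ, π)`**, the multiplicity taken as Mathlib's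
`Representation.IntertwiningMap τ.toRepresentation π.toRepresentation` (every linear intertwiner is continuous in
finite dimension, `Schur.intertwinersEquiv`). [cite: BrockerTomDieck1985, II Prop (1.14)] -/
theorem finrank_isotypicComponent_eq_mul_finrank_intertwiningMap [T2Space G] (hπc : π.IsStronglyContinuous)
    (hπu : π.IsUnitary) (hτ : Continuous (τ : G → E →L[ℂ] E)) [τ.toRepresentation.IsIrreducible]
    (hτu : ∀ (g : G) (v w : E), ⟪τ g v, τ g w⟫_ℂ = ⟪v, w⟫_ℂ) :
    Module.finrank ℂ (π.isotypicComponent τ).toSubmodule =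
      Module.finrank ℂ E *
        Module.finrank ℂ (Representation.IntertwiningMap τ.toRepresentation π.toRepresentation) := by
  rw [← (Schur.intertwinersEquiv τ π).finrank_eq]
  exact finrank_isotypicComponent_eq_mul_finrank_intertwiners hπc hπu hτ hτu

/-- **`dim τ` divides `dim H_τ`** (the isotypic component is `dim Hom_G(τ, π)` copies of `τ`, Bröcker–tom Dieck
II (1.14)). [cite: BrockerTomDieck1985, II Prop (1.14)] -/
theorem finrank_dvd_finrank_isotypicComponent [T2Space G] (hπc : π.IsStronglyContinuous) (hπu : π.IsUnitary)
    (hτ : Continuous (τ : G → E →L[ℂ] E)) [τ.toRepresentation.IsIrreducible]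
    (hτu : ∀ (g : G) (v w : E), ⟪τ g v, τ g w⟫_ℂ = ⟪v, w⟫_ℂ) :
    Module.finrank ℂ E ∣ Module.finrank ℂ (π.isotypicComponent τ).toSubmodule :=
  Dvd.intro _ (finrank_isotypicComponent_eq_mul_finrank_intertwiners hπc hπu hτ hτu).symm

/-! ### Occurrence: `H_τ ≠ 0` iff `⟨χ_π, χ_τ⟩ ≠ 0` iff a non-zero `G`-map `τ → π` exists -/

omit [TopologicalSpace G] [IsTopologicalGroup G] [MeasurableSpace G] [BorelSpace G] [CompactSpace G]
  [CompleteSpace H] [FiniteDimensional ℂ H] in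
/-- A closed subrepresentation is `⊥` iff its underlying submodule is. [cite: BrockerTomDieck1985, II Prop (1.14)] -/
private theorem closedSubrep_eq_bot_iff (N : ClosedSubrep π) : N = ⊥ ↔ N.toSubmodule = ⊥ := by
  constructor
  · rintro rfl
    rfl
  · intro h
    ext v
    rw [← ClosedSubrep.mem_toSubmodule, h, ClosedSubrep.mem_bot, Submodule.mem_bot]

/-- **`τ` does not occur in `π` iff `⟨χ_π, χ_τ⟩ = 0`**: `H_τ = 0 ↔ ∫ conj χ_τ χ_π dμ = 0` (Bröcker–tom Dieck II
(1.13)–(1.14) with (4.11): the multiplicity `⟨χ_π, χ_τ⟩` is non-zero iff `τ` is contained in `π`).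
[cite: BrockerTomDieck1985, II Thm (4.11)] [cite: BrockerTomDieck1985, II Prop (1.14)] -/
theorem isotypicComponent_eq_bot_iff_integral_eq_zero [T2Space G] (hπc : π.IsStronglyContinuous)
    (hπu : π.IsUnitary) (hτ : Continuous (τ : G → E →L[ℂ] E)) [τ.toRepresentation.IsIrreducible]
    (hτu : ∀ (g : G) (v w : E), ⟪τ g v, τ g w⟫_ℂ = ⟪v, w⟫_ℂ) :
    π.isotypicComponent τ = ⊥ ↔ ∫ g, conj (Schur.character τ g) * Schur.character π g ∂μ = 0 := by
  rw [closedSubrep_eq_bot_iff, ← Submodule.finrank_eq_zero, ← Nat.cast_eq_zero (R := ℂ),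
    finrank_isotypicComponent_eq_mul_integral μ hπc hπu hτ hτu, mul_eq_zero,
    or_iff_right (Schur.finrank_ne_zero_of_isIrreducible τ)]

/-- **`τ` occurs in `π` iff there is a non-zero intertwining operator `τ → π`**: `H_τ ≠ 0 ↔ Hom_G(τ, π) ≠ 0`
(Bröcker–tom Dieck II (1.13)–(1.14): "this multiplicity is nonzero if and only if `W` is contained in `V`").
[cite: BrockerTomDieck1985, II Prop (1.14)] -/
theorem isotypicComponent_ne_bot_iff_exists_intertwiner [T2Space G] (hπc : π.IsStronglyContinuous)
    (hπu : π.IsUnitary) (hτ : Continuous (τ : G → E →L[ℂ] E)) [τ.toRepresentation.IsIrreducible]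
    (hτu : ∀ (g : G) (v w : E), ⟪τ g v, τ g w⟫_ℂ = ⟪v, w⟫_ℂ) :
    π.isotypicComponent τ ≠ ⊥ ↔ ∃ T ∈ Schur.intertwiners τ π, T ≠ 0 := by
  borelize G
  obtain ⟨ν, hν, hν'⟩ := exists_isProbabilityMeasure_isMulLeftInvariant (G := G)
  have hπ : Continuous (π : G → H →L[ℂ] H) := Schur.continuous_of_forall_continuous_apply fun v => hπc v
  rw [Ne, isotypicComponent_eq_bot_iff_integral_eq_zero ν hπc hπu hτ hτu]
  exact (Schur.nonempty_intertwiners_ne_zero_iff ν hτ hπ hτu).symm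

end Main

end Literature.NumberTheory.Automorphic

end
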